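import Literature.MathematicalPhysics.KineticTheory.HardSphereUniformGas
import Summits.AtomisticToContinuum.HydrodynamicLimit.Theses.JParityClosure
import Summits.AtomisticToContinuum.HydrodynamicLimit.Theorems.JParityClosureEvenStressEnskogTubeStatRegular
import HarnessLib

/-!
# The Enskog rate functional has the Enskog mean at rung 0 (`stub_enskogRateMeanRung0`, helper
# stub H4 of the crux line `even-rung-mean-variance`, `JParityClosure.EvenStressEnskog`,
# stmt-AtomisticToContinuum-13079)

Under the rung-0 local Gibbs law `G_N` (constant profiles `a, u, θ`) of `N + 1` hard spheres of
diameter `σ (N+1)^{-1/3}` on `𝕋³`, the Gibbs mean of the Enskog rate functional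
`e_t(z) = ∫ χ(t,x) g(σ³ρ_r(z,x)) Y(σ³ρ_r(z,x)) B_r Ξ_L (z,x) dx` converges, as `N → ∞`, to
`(∫ χ(t,·)) · g(σ³) Y(σ³) · ∫∫ Θ Ξ_L (v, w) M(v) M(w) dv dw` (`M = M_{1,u,θ}`), for `σ` small.

Proof (statics from `Literature/…/HardSphereUniformGas`).  (i) The velocity average of the pair
functional at fixed positions is `Θ̄ · (N+1)⁻² Σ_{i ≠ j} b_r(xᵢ,x) b_r(xⱼ,x)` (`Θ(v, v) = 0` on the
diagonal; off it the pair `(vᵢ, vⱼ)` is `N(u,θ) ⊗ N(u,θ)` distributed) — `integral_vel_pairFunctional`.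
(ii) `ψ = g · Y` is bounded on `[0, ∞)` (cutoff `g = 0` on `[η₁, ∞)`, `exists_bound_mul_contactValue`) and
continuous at `σ³ ∈ (0, η₁)`, where `Y = (3/2π) F′` by the equation of state `HsEosLowDensity`; the
deterministic estimate `abs_mul_offDiag_sub_le`, integrated against the configurational Gibbs measure,
and the vanishing variance of the mollified density (`tendsto_variance_uniform`, the cone mollifier having
mass `1`) give `E[ψ(σ³ρ̄) Q] → ψ(σ³)` (`tendsto_integral_psi_offDiag`), hence the pointwise-in-`x` limit
of `E[g Y(σ³ρ_r) B_r]` through the rung-0 product structure of `G_N`.  (iii) Fubini in `x` and dominated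
convergence over the compact torus.  No uniform-in-`x` law of large numbers and no rate is needed.
-/

noncomputable section

open MeasureTheory ProbabilityTheory Set Filter Topology
open scoped ENNReal InnerProductSpace BigOperators

namespace Summit.AtomisticToContinuum.HydrodynamicLimit.Theorems.EvenStressEnskog

open Literature.Analysis.FluidPDE Literature.MathematicalPhysics.KineticTheory
open Literature.MathematicalPhysics.StatisticalMechanics
open Summit.AtomisticToContinuum.HydrodynamicLimit.Theses.JParityClosure

/-! ## The Enskog side at rung 0 -/

/-- **Velocity average of the pair functional at fixed positions.**  Under `⊗ᵢ N(u, θ id)`,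
`∫ B_r Ξ_L (zipConfig (x, v), x₀) dv = Θ̄ · (N+1)⁻² Σ_{i ≠ j} b_r(xᵢ, x₀) b_r(xⱼ, x₀)` with
`Θ̄ = ∫ Θ Ξ_L d(N(u,θ) ⊗ N(u,θ))`: the diagonal terms vanish (`sphereMark_diag`) and each off-diagonal
pair of velocities is `N(u,θ) ⊗ N(u,θ)` distributed (`integral_pi_pair`). [folklore] -/
theorem integral_vel_pairFunctional {N : ℕ} (u : V3) (θ : ℝ) (k l : Fin 3) {L : ℝ} (hL : 0 ≤ L)
    (r : ℝ) (xs : Fin (N + 1) → T3) (x₀ : T3) :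
    ∫ vs, pairFunctional r (evenMarkTrunc k l L) (zipConfig (xs, vs)) x₀
        ∂(Measure.pi fun _ : Fin (N + 1) => gaussMeasure u θ) =
      (∫ p, sphereMark (evenMarkTrunc k l L) p.1 p.2 ∂((gaussMeasure u θ).prod (gaussMeasure u θ))) *
        ((((N + 1 : ℕ) : ℝ))⁻¹ * (((N + 1 : ℕ) : ℝ))⁻¹ *
          ∑ i, ∑ j, if i = j then 0 else coneKernel r (xs i) x₀ * coneKernel r (xs j) x₀) := by
  have hΘc : Continuous fun p : V3 × V3 => sphereMark (evenMarkTrunc k l L) p.1 p.2 :=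
    continuous_sphereMark (continuous_evenMarkTrunc k l L)
  have hint : ∀ i j : Fin (N + 1), Integrable (fun vs : Fin (N + 1) → V3 =>
      sphereMark (evenMarkTrunc k l L) (vs i) (vs j)) (Measure.pi fun _ : Fin (N + 1) => gaussMeasure u θ) := by
    intro i j
    have hf : Continuous fun vs : Fin (N + 1) → V3 => (vs i, vs j) :=
      (continuous_apply i).prodMk (continuous_apply j)
    refine Integrable.mono' (integrable_const (2 * L * (2 * L) *
      (sphereMeasure : Measure (Metric.sphere (0 : V3) 1)).real univ)) (hΘc.comp hf).aestronglyMeasurable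
      (ae_of_all _ fun vs => ?_)
    rw [Real.norm_eq_abs]
    exact abs_sphereMark_evenMarkTrunc_le k l hL _ _
  have hterm : ∀ i j : Fin (N + 1), ∫ vs, sphereMark (evenMarkTrunc k l L) (vs i) (vs j)
      ∂(Measure.pi fun _ : Fin (N + 1) => gaussMeasure u θ) = if i = j then 0 else
        ∫ p, sphereMark (evenMarkTrunc k l L) p.1 p.2 ∂((gaussMeasure u θ).prod (gaussMeasure u θ)) := by
    intro i j
    split_ifs with hij
    · subst hij; simp_rw [sphereMark_diag]; exact integral_zero _ _
    · exact integral_pi_pair (gaussMeasure u θ) hij hΘc.aestronglyMeasurable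
  simp only [pairFunctional_eq_sum, zipConfig_apply]
  rw [integral_const_mul, integral_finsetSum _ fun i _ => integrable_finsetSum _ fun j _ => (hint i j).const_mul _]
  have inner : ∀ i : Fin (N + 1), ∫ vs, ∑ j, coneKernel r (xs i) x₀ * coneKernel r (xs j) x₀ *
      sphereMark (evenMarkTrunc k l L) (vs i) (vs j) ∂(Measure.pi fun _ : Fin (N + 1) => gaussMeasure u θ) =
      (∫ p, sphereMark (evenMarkTrunc k l L) p.1 p.2 ∂((gaussMeasure u θ).prod (gaussMeasure u θ))) *
        ∑ j, (if i = j then 0 else coneKernel r (xs i) x₀ * coneKernel r (xs j) x₀) := by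
    intro i
    rw [integral_finsetSum _ fun j _ => (hint i j).const_mul _, Finset.mul_sum]
    refine Finset.sum_congr rfl fun j _ => ?_
    rw [integral_const_mul, hterm]
    split_ifs <;> ring
  simp_rw [inner, ← Finset.mul_sum]
  ring

/-- **The position average converges.**  For the uniform gas at small reduced density `σ`
(configurational Gibbs measure of `N + 1` spheres of diameter `σ(N+1)^{-1/3}`, constant activity
`a > 0`), `ψ` measurable, bounded by `K` on `[0, ∞)` and continuous at `s > 0`, and a continuous weight
`0 ≤ b ≤ M` of total mass `1`: with `ρ̄ = (N+1)⁻¹ Σ b(xᵢ)` and `Q = (N+1)⁻² Σ_{i ≠ j} b(xᵢ) b(xⱼ)`,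
`E[ψ(s ρ̄) Q] → ψ(s)` — the deterministic estimate `abs_mul_offDiag_sub_le` integrated, and the variance
limit `tendsto_variance_uniform`. [folklore] -/
theorem tendsto_integral_psi_offDiag {σ a : ℝ} (h : SmallDensity uniformProfile σ) (ha : 0 < a)
    {ψ : ℝ → ℝ} (hψm : Measurable ψ) {K : ℝ} (hK : ∀ y, 0 ≤ y → |ψ y| ≤ K) {s : ℝ} (hs : 0 < s)
    (hcont : ContinuousAt ψ s) {b : T3 → ℝ} (hbc : Continuous b) {M : ℝ}
    (hb : ∀ y, 0 ≤ b y ∧ b y ≤ M) (hb1 : ∫ y, b y = 1) :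
    Tendsto (fun N : ℕ => ∫ xs, ψ (s * ((((N + 1 : ℕ) : ℝ))⁻¹ * ∑ i, b (xs i))) *
        ((((N + 1 : ℕ) : ℝ))⁻¹ * (((N + 1 : ℕ) : ℝ))⁻¹ * ∑ i, ∑ j, if i = j then 0 else b (xs i) * b (xs j))
        ∂posGibbsMeasure (fun _ : T3 => a) (hsDiameter σ N) (N + 1)) atTop (𝓝 (ψ s)) := by
  have hM : 0 ≤ M := (hb 0).1.trans (hb 0).2
  have hK0 : 0 ≤ K := (abs_nonneg _).trans (hK 0 le_rfl)
  haveI hprob : ∀ N : ℕ, IsProbabilityMeasure (posGibbsMeasure (fun _ : T3 => a) (hsDiameter σ N) (N + 1)) :=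
    fun N => isProbabilityMeasure_posGibbsMeasure continuous_const (fun _ => ha) h.σ_lt_half.le N
  -- continuous functions of the positions are integrable
  have hintc : ∀ (N : ℕ) {f : (Fin (N + 1) → T3) → ℝ}, Continuous f →
      Integrable f (posGibbsMeasure (fun _ : T3 => a) (hsDiameter σ N) (N + 1)) :=
    fun N f hf => hf.integrable_of_hasCompactSupport (isClosed_tsupport _).isCompact
  have hρc : ∀ N : ℕ, Continuous fun xs : Fin (N + 1) → T3 => (((N + 1 : ℕ) : ℝ))⁻¹ * ∑ i, b (xs i) :=
    fun N => continuous_const.mul (continuous_finsetSum _ fun i _ => hbc.comp (continuous_apply i))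
  have hQc : ∀ N : ℕ, Continuous fun xs : Fin (N + 1) → T3 => (((N + 1 : ℕ) : ℝ))⁻¹ * (((N + 1 : ℕ) : ℝ))⁻¹ *
      ∑ i, ∑ j, (if i = j then (0 : ℝ) else b (xs i) * b (xs j)) := by
    intro N
    refine continuous_const.mul (continuous_finsetSum _ fun i _ => continuous_finsetSum _ fun j _ => ?_)
    split_ifs
    · exact continuous_const
    · exact (hbc.comp (continuous_apply i)).mul (hbc.comp (continuous_apply j))
  -- the variance tends to zero
  set V : ℕ → ℝ := fun N => ∫ xs, ((((N + 1 : ℕ) : ℝ))⁻¹ * ∑ i, b (xs i) - 1) ^ 2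
    ∂posGibbsMeasure (fun _ : T3 => a) (hsDiameter σ N) (N + 1) with hV
  have hVlim : Tendsto V atTop (𝓝 0) := by
    have h1 := tendsto_variance_uniform h hbc
    rw [hb1] at h1
    refine h1.congr fun N => ?_
    simp only [hV]
    rw [integral_posGibbsMeasure_const ha, div_eq_inv_mul]
    rfl
  rw [Metric.tendsto_atTop]
  intro η hη
  have hA : 0 < K * (M + 1) + 1 := by positivity
  obtain ⟨δ, hδ, hδε⟩ := Metric.continuousAt_iff.1 hcont (η / (4 * (K * (M + 1) + 1))) (by positivity)
  set ε := η / (4 * (K * (M + 1) + 1)) with hε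
  have hε0 : 0 < ε := by positivity
  set C := K * (M + 1) / (4 * ε) + 2 * K * s ^ 2 / δ ^ 2 with hC
  have hR : Tendsto (fun N : ℕ => C * V N + K * M ^ 2 * (((N + 1 : ℕ) : ℝ))⁻¹) atTop (𝓝 0) := by
    have h1 : Tendsto (fun N : ℕ => (((N + 1 : ℕ) : ℝ))⁻¹) atTop (𝓝 0) :=
      tendsto_inv_atTop_zero.comp ((tendsto_natCast_atTop_atTop (R := ℝ)).comp (tendsto_add_atTop_nat 1))
    simpa using (hVlim.const_mul C).add (h1.const_mul (K * M ^ 2))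
  obtain ⟨N₀, hN₀⟩ := Metric.tendsto_atTop.1 hR (η / 2) (by positivity)
  refine ⟨N₀, fun N hN => ?_⟩
  have hRN := hN₀ N hN
  rw [Real.dist_eq, sub_zero] at hRN
  set μ := posGibbsMeasure (fun _ : T3 => a) (hsDiameter σ N) (N + 1) with hμ
  set ρ : (Fin (N + 1) → T3) → ℝ := fun xs => (((N + 1 : ℕ) : ℝ))⁻¹ * ∑ i, b (xs i) with hρ
  set Q : (Fin (N + 1) → T3) → ℝ := fun xs => (((N + 1 : ℕ) : ℝ))⁻¹ * (((N + 1 : ℕ) : ℝ))⁻¹ *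
    ∑ i, ∑ j, (if i = j then (0 : ℝ) else b (xs i) * b (xs j)) with hQ
  -- the pointwise bound and its integral
  have hpt : ∀ xs, |ψ (s * ρ xs) * Q xs - ψ s| ≤
      (K * (M + 1) + 1) * ε + C * (ρ xs - 1) ^ 2 + K * M ^ 2 * (((N + 1 : ℕ) : ℝ))⁻¹ := fun xs =>
    abs_mul_offDiag_sub_le hK hM hs hε0 hδ (fun y hy => hδε hy) (fun i => b (xs i)) fun i => hb _
  have hsqc : Continuous fun xs : Fin (N + 1) → T3 => (ρ xs - 1) ^ 2 := ((hρc N).sub continuous_const).pow 2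
  have hI0 : Integrable (fun _ : Fin (N + 1) → T3 => (K * (M + 1) + 1) * ε) μ := integrable_const _
  have hI1 : Integrable (fun xs : Fin (N + 1) → T3 => C * (ρ xs - 1) ^ 2) μ := (hintc N hsqc).const_mul C
  have hI2 : Integrable (fun _ : Fin (N + 1) → T3 => K * M ^ 2 * (((N + 1 : ℕ) : ℝ))⁻¹) μ :=
    integrable_const _
  have hI01 : Integrable (fun xs : Fin (N + 1) → T3 => (K * (M + 1) + 1) * ε + C * (ρ xs - 1) ^ 2) μ :=
    hI0.add hI1
  have hGi : Integrable (fun xs => (K * (M + 1) + 1) * ε + C * (ρ xs - 1) ^ 2 +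
      K * M ^ 2 * (((N + 1 : ℕ) : ℝ))⁻¹) μ := hI01.add hI2
  have hFm : AEStronglyMeasurable (fun xs => ψ (s * ρ xs) * Q xs - ψ s) μ :=
    (((hψm.comp (continuous_const.mul (hρc N)).measurable).mul (hQc N).measurable).sub
      measurable_const).aestronglyMeasurable
  have hFi : Integrable (fun xs => ψ (s * ρ xs) * Q xs - ψ s) μ :=
    hGi.mono' hFm (ae_of_all _ fun xs => by rw [Real.norm_eq_abs]; exact hpt xs)
  have hFi' : Integrable (fun xs => ψ (s * ρ xs) * Q xs) μ :=
    (hFi.add (integrable_const (ψ s))).congr (ae_of_all _ fun xs => by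
      simp only [Pi.add_apply, sub_add_cancel])
  rw [Real.dist_eq]
  calc |∫ xs, ψ (s * ρ xs) * Q xs ∂μ - ψ s| = |∫ xs, (ψ (s * ρ xs) * Q xs - ψ s) ∂μ| := by
        rw [integral_sub hFi' (integrable_const _), integral_const, smul_eq_mul, probReal_univ, one_mul]
    _ ≤ ∫ xs, |ψ (s * ρ xs) * Q xs - ψ s| ∂μ := abs_integral_le_integral_abs
    _ ≤ ∫ xs, ((K * (M + 1) + 1) * ε + C * (ρ xs - 1) ^ 2 + K * M ^ 2 * (((N + 1 : ℕ) : ℝ))⁻¹) ∂μ :=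
        integral_mono_of_nonneg (ae_of_all _ fun _ => abs_nonneg _) hGi (ae_of_all _ hpt)
    _ = (K * (M + 1) + 1) * ε + (C * V N + K * M ^ 2 * (((N + 1 : ℕ) : ℝ))⁻¹) := by
        have hVN : ∫ xs, (ρ xs - 1) ^ 2 ∂μ = V N := rfl
        rw [integral_add hI01 hI2, integral_add hI0 hI1, integral_const, integral_const, integral_const_mul,
          smul_eq_mul, smul_eq_mul, probReal_univ, one_mul, one_mul, hVN]
        ring
    _ < η := by
        have h1 : (K * (M + 1) + 1) * ε = η / 4 := by
          rw [hε]; field_simp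
        have h2 : C * V N + K * M ^ 2 * (((N + 1 : ℕ) : ℝ))⁻¹ < η / 2 := (le_abs_self _).trans_lt hRN
        linarith


/-! ## The registered stub -/

/-- **H4 · the Enskog rate functional has the Enskog mean at rung 0** (registered helper stub
`stub_enskogRateMeanRung0` of the line `even-rung-mean-variance`, verbatim).  From `HsEosLowDensity` take
`η₁ := min (η'/2) η₀` (`η'` the analyticity radius of the equation of state, `η₀` the cutoff scale of
`exists_bound_mul_contactValue`) and `σ₀` the smallness of `exists_smallDensity` for the uniform profile:
for `0 < σ < σ₀`, `σ³ < η₁`, constant profiles `a, θ > 0`, `u`, continuous `χ, g` with `g = 0` on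
`[η₁, ∞)`, `0 ≤ L`, `0 < r < 1/4`, any `t` and any flows, `E_{G_N}[e_t] → (∫χ(t,·)) g(σ³) Y(σ³) Θ̄_{MM}`.
[folklore] -/
theorem stub_enskogRateMeanRung0 :
    HsEosLowDensity →
    ∃ η₁ : ℝ, 0 < η₁ ∧ ∃ σ₀ : ℝ, 0 < σ₀ ∧ ∀ (σ a θ : ℝ) (u : V3) (χ : ℝ × UnitAddTorus (Fin 3) → ℝ)
      (g : ℝ → ℝ) (k l : Fin 3) (L r t : ℝ),
      0 < σ → σ < σ₀ → σ ^ 3 < η₁ → 0 < a → 0 < θ → Continuous χ → Continuous g →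
      (∀ b, η₁ ≤ b → g b = 0) → 0 ≤ L → 0 < r → r < 1 / 4 →
      ∀ Φ : (N : ℕ) → HardSphereFlow (Torus.geometry (Fin 3)) (hsDiameter σ N) (N + 1),
        Tendsto (fun N : ℕ => ∫ z, enskogRate σ N χ g (evenMarkTrunc k l L) r t z
            ∂(localGibbsLaw σ (fun _ => a) (fun _ => u) (fun _ => θ) N (Φ N)))
          atTop
          (𝓝 ((∫ x : UnitAddTorus (Fin 3), χ (t, x)) * g (σ ^ 3) * contactValue (σ ^ 3) *
            ∫ p : V3 × V3, sphereMark (evenMarkTrunc k l L) p.1 p.2 *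
              (localMaxwellian 1 θ u p.1 * localMaxwellian 1 θ u p.2))) := by
  intro hE
  obtain ⟨η₀, hη₀, hbound⟩ := exists_bound_mul_contactValue hE
  obtain ⟨η', hη', F, hF, hEq, -, -, -⟩ := hE
  obtain ⟨σ₀, hσ₀, hsmall⟩ := exists_smallDensity uniformProfile one_pos
  refine ⟨min (η' / 2) η₀, lt_min (by positivity) hη₀, σ₀, hσ₀, ?_⟩
  intro σ a θ u χ g k l L r t hσ hσσ₀ hσ3 ha hθ hχ hg hg0 hL hr hr4 Φ
  have hsd : SmallDensity uniformProfile σ := (hsmall σ hσ hσσ₀).1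
  have hσ2 : σ ≤ 1 / 2 := hsd.σ_lt_half.le
  have hr2 : r < 1 / 2 := by linarith
  -- `ψ = g · Y`: measurable, bounded on `[0, ∞)`, continuous at `σ³ ∈ (0, η')`
  obtain ⟨K, hK0, hK⟩ := hbound g hg fun b hb => hg0 b ((min_le_right _ _).trans hb)
  have hs : 0 < σ ^ 3 := pow_pos hσ 3
  have hs' : σ ^ 3 < η' := by have := (lt_min_iff.1 hσ3).1; linarith
  set ψ : ℝ → ℝ := fun b => g b * contactValue b with hψ
  have hψm : Measurable ψ := hg.measurable.mul measurable_contactValue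
  have hψc : ContinuousAt ψ (σ ^ 3) := by
    have hnhds : hsExcessFreeEnergy =ᶠ[𝓝 (σ ^ 3)] F :=
      Filter.eventuallyEq_of_mem (isOpen_Ioo.mem_nhds ⟨hs, hs'⟩) (hEq.mono Ioo_subset_Ico_self)
    have hY : (fun b => 3 / (2 * Real.pi) * deriv F b) =ᶠ[𝓝 (σ ^ 3)] contactValue :=
      hnhds.deriv.mono fun b hb => by rw [contactValue, hb]
    have hFc : ContinuousAt (deriv F) (σ ^ 3) :=
      hF.deriv.continuousOn.continuousAt (isOpen_Ioo.mem_nhds ⟨by linarith, hs'⟩)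
    exact hg.continuousAt.mul ((hFc.const_mul _).congr hY)
  -- sizes: the cone kernel, the pair functional
  have hbM : ∀ y x₀ : T3, 0 ≤ coneKernel r y x₀ ∧ coneKernel r y x₀ ≤ 3 / (Real.pi * r ^ 3) :=
    fun y x₀ => coneKernel_nonneg_le hr y x₀
  have hΞc : Continuous (evenMarkTrunc k l L) := continuous_evenMarkTrunc k l L
  have hB : ∀ (N : ℕ) (z : Config (N + 1) (Fin 3) T3) (x₀ : T3),
      |pairFunctional r (evenMarkTrunc k l L) z x₀| ≤ 3 / (Real.pi * r ^ 3) * (3 / (Real.pi * r ^ 3)) *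
        (2 * L * (2 * L) * (sphereMeasure : Measure (Metric.sphere (0 : V3) 1)).real univ) := by
    intro N z x₀
    rw [pairFunctional_eq_sum]
    refine (abs_const_mul_sum_sum_le_of (B := 3 / (Real.pi * r ^ 3) * (3 / (Real.pi * r ^ 3)) *
      (2 * L * (2 * L) * (sphereMeasure : Measure (Metric.sphere (0 : V3) 1)).real univ))
      (by positivity) _ fun i j => ?_).trans (le_of_eq ?_)
    · rw [abs_mul, abs_mul]
      exact mul_le_mul (mul_le_mul (abs_coneKernel_le hr _ _) (abs_coneKernel_le hr _ _) (abs_nonneg _)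
        (by positivity)) (abs_sphereMark_evenMarkTrunc_le k l hL _ _) (abs_nonneg _) (by positivity)
    · have hN : ((N : ℝ) + 1) ≠ 0 := by positivity
      push_cast
      field_simp
  set Bb : ℝ := 3 / (Real.pi * r ^ 3) * (3 / (Real.pi * r ^ 3)) *
    (2 * L * (2 * L) * (sphereMeasure : Measure (Metric.sphere (0 : V3) 1)).real univ) with hBb
  haveI hLG : ∀ N : ℕ, IsProbabilityMeasure (localGibbsLaw σ (fun _ => a) (fun _ => u) (fun _ => θ) N (Φ N)) :=
    fun N => isProbabilityMeasure_localGibbsLaw continuous_const continuous_const continuous_const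
      (fun _ => ha) (fun _ => hθ) hσ2 N (Φ N)
  haveI hPG : ∀ N : ℕ, IsProbabilityMeasure (posGibbsMeasure (fun _ : T3 => a) (hsDiameter σ N) (N + 1)) :=
    fun N => isProbabilityMeasure_posGibbsMeasure continuous_const (fun _ => ha) hσ2 N
  -- joint measurability of the reduced integrand `ψ(σ³ρ_r(z, x)) B_r(z, x)`
  have hf2 : ∀ N : ℕ, Measurable fun q : Config (N + 1) (Fin 3) T3 × T3 =>
      ψ (σ ^ 3 * mollDensity r q.1 q.2) * pairFunctional r (evenMarkTrunc k l L) q.1 q.2 := by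
    intro N
    haveI : OpensMeasurableSpace (Config (N + 1) (Fin 3) T3 × T3) := Prod.opensMeasurableSpace
    have hρ : Continuous fun q : Config (N + 1) (Fin 3) T3 × T3 => σ ^ 3 * mollDensity r q.1 q.2 :=
      continuous_const.mul (continuous_mollDensity_comp r continuous_fst continuous_snd)
    exact (hψm.comp hρ.measurable).mul
      (continuous_pairFunctional_comp r hΞc continuous_fst continuous_snd).measurable
  have hf1 : ∀ (N : ℕ) (x₀ : T3), Measurable fun z : Config (N + 1) (Fin 3) T3 =>
      ψ (σ ^ 3 * mollDensity r z x₀) * pairFunctional r (evenMarkTrunc k l L) z x₀ := by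
    intro N x₀
    have hρ : Continuous fun z : Config (N + 1) (Fin 3) T3 => σ ^ 3 * mollDensity r z x₀ :=
      continuous_const.mul (continuous_mollDensity_comp r continuous_id continuous_const)
    exact (hψm.comp hρ.measurable).mul
      (continuous_pairFunctional_comp r hΞc continuous_id continuous_const).measurable
  have hfb : ∀ (N : ℕ) (z : Config (N + 1) (Fin 3) T3) (x₀ : T3),
      |ψ (σ ^ 3 * mollDensity r z x₀) * pairFunctional r (evenMarkTrunc k l L) z x₀| ≤ K * Bb := by
    intro N z x₀
    rw [abs_mul]
    exact mul_le_mul (hK _ (mul_nonneg hs.le (mollDensity_nonneg hr _ _))) (hB N z x₀) (abs_nonneg _) hK0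
  -- STEP 1: reduction of `J_N(x₀) = E[ψ B_r]` to the position average of `ψ(σ³ρ̄) Q`
  have hJ : ∀ (x₀ : T3) (N : ℕ),
      ∫ z, ψ (σ ^ 3 * mollDensity r z x₀) * pairFunctional r (evenMarkTrunc k l L) z x₀
          ∂(localGibbsLaw σ (fun _ => a) (fun _ => u) (fun _ => θ) N (Φ N)) =
        (∫ p, sphereMark (evenMarkTrunc k l L) p.1 p.2 ∂((gaussMeasure u θ).prod (gaussMeasure u θ))) *
          ∫ xs, ψ (σ ^ 3 * ((((N + 1 : ℕ) : ℝ))⁻¹ * ∑ i, coneKernel r (xs i) x₀)) *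
            ((((N + 1 : ℕ) : ℝ))⁻¹ * (((N + 1 : ℕ) : ℝ))⁻¹ *
              ∑ i, ∑ j, if i = j then 0 else coneKernel r (xs i) x₀ * coneKernel r (xs j) x₀)
            ∂posGibbsMeasure (fun _ : T3 => a) (hsDiameter σ N) (N + 1) := by
    intro x₀ N
    rw [integral_localGibbsLaw_rung0 σ ha.le hθ u N (Φ N), integral_prod]
    · have e : ∀ (xs : Fin (N + 1) → T3) (vs : Fin (N + 1) → V3),
          σ ^ 3 * mollDensity r (zipConfig (xs, vs)) x₀ =
            σ ^ 3 * ((((N + 1 : ℕ) : ℝ))⁻¹ * ∑ i, coneKernel r (xs i) x₀) := by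
        intro xs vs; simp only [mollDensity_eq_sum, zipConfig_apply]
      have hv := fun xs : Fin (N + 1) → T3 => integral_vel_pairFunctional u θ k l hL r xs x₀
      simp_rw [e, integral_const_mul, hv]
      rw [← integral_const_mul]
      exact integral_congr_ae (ae_of_all _ fun xs => by ring)
    · exact Integrable.mono' (integrable_const (K * Bb)) ((hf1 N x₀).comp measurable_zipConfig).aestronglyMeasurable
        (ae_of_all _ fun p => by rw [Real.norm_eq_abs]; exact hfb N _ _)
  -- STEP 2: the pointwise-in-`x₀` limit
  have hlim : ∀ x₀ : T3, Tendsto (fun N : ℕ =>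
      ∫ z, ψ (σ ^ 3 * mollDensity r z x₀) * pairFunctional r (evenMarkTrunc k l L) z x₀
        ∂(localGibbsLaw σ (fun _ => a) (fun _ => u) (fun _ => θ) N (Φ N))) atTop
      (𝓝 ((∫ p, sphereMark (evenMarkTrunc k l L) p.1 p.2 ∂((gaussMeasure u θ).prod (gaussMeasure u θ))) *
        ψ (σ ^ 3))) := fun x₀ =>
    ((tendsto_integral_psi_offDiag hsd ha hψm hK hs hψc
      (continuous_coneKernel_comp r continuous_id continuous_const) (fun y => hbM y x₀)
      (integral_coneKernel hr hr2 x₀)).const_mul _).congr fun N => (hJ x₀ N).symm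
  -- STEP 3: Fubini — `E[e_t] = ∫ χ(t, x₀) J_N(x₀) dx₀`
  obtain ⟨Cχ, hCχ0, hCχ⟩ := exists_forall_abs_le_of_continuous (χ := fun x => χ (t, x))
    (hχ.comp (continuous_const.prodMk continuous_id))
  have hE : ∀ N : ℕ, ∫ z, enskogRate σ N χ g (evenMarkTrunc k l L) r t z
      ∂(localGibbsLaw σ (fun _ => a) (fun _ => u) (fun _ => θ) N (Φ N)) =
      ∫ x₀, χ (t, x₀) * ∫ z, ψ (σ ^ 3 * mollDensity r z x₀) * pairFunctional r (evenMarkTrunc k l L) z x₀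
        ∂(localGibbsLaw σ (fun _ => a) (fun _ => u) (fun _ => θ) N (Φ N)) := by
    intro N
    have hswap := integral_integral_swap (μ := localGibbsLaw σ (fun _ => a) (fun _ => u) (fun _ => θ) N (Φ N))
      (ν := (volume : Measure T3)) (f := fun z x₀ => χ (t, x₀) *
        (ψ (σ ^ 3 * mollDensity r z x₀) * pairFunctional r (evenMarkTrunc k l L) z x₀)) ?_
    · calc ∫ z, enskogRate σ N χ g (evenMarkTrunc k l L) r t z
            ∂(localGibbsLaw σ (fun _ => a) (fun _ => u) (fun _ => θ) N (Φ N))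
          = ∫ z, (∫ x₀, χ (t, x₀) * (ψ (σ ^ 3 * mollDensity r z x₀) *
              pairFunctional r (evenMarkTrunc k l L) z x₀))
              ∂(localGibbsLaw σ (fun _ => a) (fun _ => u) (fun _ => θ) N (Φ N)) := by
            refine integral_congr_ae (ae_of_all _ fun z => ?_)
            unfold enskogRate
            exact integral_congr_ae (ae_of_all _ fun x₀ => by simp only [hψ]; ring)
        _ = _ := hswap
        _ = _ := integral_congr_ae (ae_of_all _ fun x₀ => integral_const_mul _ _)
    · haveI : OpensMeasurableSpace (Config (N + 1) (Fin 3) T3 × T3) := Prod.opensMeasurableSpace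
      have h1 : Measurable fun q : Config (N + 1) (Fin 3) T3 × T3 => χ (t, q.2) :=
        (hχ.comp (continuous_const.prodMk continuous_snd)).measurable
      refine Integrable.mono' (integrable_const (Cχ * (K * Bb))) (h1.mul (hf2 N)).aestronglyMeasurable
        (ae_of_all _ fun q => ?_)
      rw [Real.norm_eq_abs]
      dsimp only [Function.uncurry]
      rw [abs_mul]
      exact mul_le_mul (hCχ q.2) (hfb N q.1 q.2) (abs_nonneg _) hCχ0
  -- STEP 4: dominated convergence over the torus
  have hmain : Tendsto (fun N : ℕ => ∫ x₀, χ (t, x₀) *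
      ∫ z, ψ (σ ^ 3 * mollDensity r z x₀) * pairFunctional r (evenMarkTrunc k l L) z x₀
        ∂(localGibbsLaw σ (fun _ => a) (fun _ => u) (fun _ => θ) N (Φ N))) atTop
      (𝓝 (∫ x₀, χ (t, x₀) * ((∫ p, sphereMark (evenMarkTrunc k l L) p.1 p.2
        ∂((gaussMeasure u θ).prod (gaussMeasure u θ))) * ψ (σ ^ 3)))) := by
    refine tendsto_integral_of_dominated_convergence (fun _ => Cχ * (K * Bb)) (fun N => ?_)
      (integrable_const _) (fun N => ae_of_all _ fun x₀ => ?_) (ae_of_all _ fun x₀ => (hlim x₀).const_mul _)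
    · have hJm : StronglyMeasurable fun x₀ : T3 => ∫ z, ψ (σ ^ 3 * mollDensity r z x₀) *
          pairFunctional r (evenMarkTrunc k l L) z x₀
          ∂(localGibbsLaw σ (fun _ => a) (fun _ => u) (fun _ => θ) N (Φ N)) :=
        (hf2 N).stronglyMeasurable.integral_prod_left'
      exact ((hχ.comp (continuous_const.prodMk continuous_id)).measurable.mul hJm.measurable).aestronglyMeasurable
    · have hJb : |∫ z, ψ (σ ^ 3 * mollDensity r z x₀) * pairFunctional r (evenMarkTrunc k l L) z x₀
          ∂(localGibbsLaw σ (fun _ => a) (fun _ => u) (fun _ => θ) N (Φ N))| ≤ K * Bb := by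
        have h := norm_integral_le_of_norm_le_const
          (μ := localGibbsLaw σ (fun _ => a) (fun _ => u) (fun _ => θ) N (Φ N))
          (f := fun z => ψ (σ ^ 3 * mollDensity r z x₀) * pairFunctional r (evenMarkTrunc k l L) z x₀)
          (C := K * Bb) (ae_of_all _ fun z => by rw [Real.norm_eq_abs]; exact hfb N z x₀)
        simpa only [Real.norm_eq_abs, probReal_univ, mul_one] using h
      rw [Real.norm_eq_abs, abs_mul]
      exact mul_le_mul (hCχ x₀) hJb (abs_nonneg _) hCχ0
  -- conclusion
  have hval : ∫ x₀, χ (t, x₀) * ((∫ p, sphereMark (evenMarkTrunc k l L) p.1 p.2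
      ∂((gaussMeasure u θ).prod (gaussMeasure u θ))) * ψ (σ ^ 3)) =
      (∫ x : UnitAddTorus (Fin 3), χ (t, x)) * g (σ ^ 3) * contactValue (σ ^ 3) *
        ∫ p : V3 × V3, sphereMark (evenMarkTrunc k l L) p.1 p.2 *
          (localMaxwellian 1 θ u p.1 * localMaxwellian 1 θ u p.2) := by
    rw [integral_mul_const, integral_prod_gaussMeasure hθ u]
    simp only [hψ]
    ring
  rw [hval] at hmain
  exact hmain.congr fun N => (hE N).symm

end Summit.AtomisticToContinuum.HydrodynamicLimit.Theorems.EvenStressEnskog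

end
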